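import Summits.RiemannHypothesis.RiemannHypothesis.Theorems.OddSectorOddBartaFloorDefs
import HarnessLib

/-!
# The prime term of the truncated odd tail kernel (crux OddBartaFloor, line Sketch, stub tailPrime)

For a window test `g` (`IsWeilTest g`, `tsupport g ⊆ [−a, a]`, `0 < a ≤ b`), the truncated odd
tail `R = R_{a,b} = oddThetaTailTrunc a b = H_b − H_a` (real, bounded, measurable, supported in
`[−b, b]`) and the kernel `k = g ⋆ R̃ = weilConv g (weilReflect R)`, the prime term of Weil's
explicit formula is

  `Σ_n Λ(n) n^{-1/2} (k(log n) + k(−log n)) = ∫ g(t) P(t) dt`,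
  `P(t) = oddThetaPrimeLayerTrunc a b t = Σ_n Λ(n) n^{-1/2} (R(t − log n) + R(t + log n))`,

and `g · P` is integrable. Proof: `k(x) = ∫ g(u) R(u − x) du` (`weilConv_apply`, `R` real), `k`
vanishes for `|x| > a + b`, so the prime sum is finite (`n < ⌈e^{a+b+1}⌉`); on the window
`|t| ≤ a` the layer `P(t)` is the same finite sum, and off the window `g = 0`; the finite sum is
then exchanged with the integral (`integral_finsetSum`). Elementary (Bombieri 2000, Thm. 2 for the
shape of the prime term). [folklore]
-/

set_option linter.dupNamespace false

noncomputable section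

open Set MeasureTheory Filter Complex
open scoped Real Topology ComplexConjugate ArithmeticFunction.vonMangoldt ENNReal

namespace Summit.RiemannHypothesis.RiemannHypothesis.Theorems.OddBartaFloor

open Literature.NumberTheory.LFunctions

/-- The truncated tail vanishes for `|s| > b` (when `a ≤ b`). [folklore] -/
private theorem tailPrime_trunc_eq_zero {a b s : ℝ} (hab : a ≤ b) (hs : b < |s|) :
    oddThetaTailTrunc a b s = 0 := by
  have hb : s ∉ Icc (-b) b := fun h => by
    have := abs_le.2 ⟨h.1, h.2⟩
    linarith
  have ha : s ∉ Icc (-a) a := fun h => by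
    have := abs_le.2 ⟨h.1, h.2⟩
    linarith
  rw [oddThetaTailTrunc_def, weilOddThetaVector_of_not_mem hb, weilOddThetaVector_of_not_mem ha,
    sub_zero]

/-- The truncated tail is measurable. [folklore] -/
private theorem tailPrime_measurable (a b : ℝ) : Measurable (oddThetaTailTrunc a b) :=
  (measurable_weilOddThetaVector b).sub (measurable_weilOddThetaVector a)

/-- The truncated tail is bounded. [folklore] -/
private theorem tailPrime_bound (a b : ℝ) : ∃ C : ℝ, ∀ s : ℝ, |oddThetaTailTrunc a b s| ≤ C := by
  obtain ⟨Ca, -, hCa⟩ := exists_abs_weilOddThetaVector_le a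
  obtain ⟨Cb, -, hCb⟩ := exists_abs_weilOddThetaVector_le b
  exact ⟨Cb + Ca, fun s => (abs_sub _ _).trans (add_le_add (hCb s) (hCa s))⟩

/-- `u ↦ g(u) R(u − c)` is integrable for a Weil test `g` (continuous of compact support times
bounded measurable). [folklore] -/
private theorem tailPrime_integrable_mul {g : ℝ → ℂ} (hg : IsWeilTest g) (a b c : ℝ) :
    Integrable fun u => g u * ((oddThetaTailTrunc a b (u - c) : ℝ) : ℂ) := by
  obtain ⟨C, hC⟩ := tailPrime_bound a b
  refine (hg.1.continuous.integrable_of_hasCompactSupport hg.2).mul_bdd (c := C) ?_ ?_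
  · exact (Complex.measurable_ofReal.comp
      ((tailPrime_measurable a b).comp (measurable_id.sub_const c))).aestronglyMeasurable
  · exact Eventually.of_forall fun u => by
      rw [Complex.norm_real, Real.norm_eq_abs]
      exact hC _

/-- `u ↦ g(u) R(u + c)` is integrable for a Weil test `g`. [folklore] -/
private theorem tailPrime_integrable_mul' {g : ℝ → ℂ} (hg : IsWeilTest g) (a b c : ℝ) :
    Integrable fun u => g u * ((oddThetaTailTrunc a b (u + c) : ℝ) : ℂ) := by
  simpa only [sub_neg_eq_add] using tailPrime_integrable_mul hg a b (-c)

/-- The kernel: `(g ⋆ R̃)(x) = ∫ g(u) R(u − x) du` (`R` real). [folklore] -/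
private theorem tailPrime_conv_apply (g : ℝ → ℂ) (a b x : ℝ) :
    weilConv g (weilReflect fun t => ((oddThetaTailTrunc a b t : ℝ) : ℂ)) x =
      ∫ u, g u * ((oddThetaTailTrunc a b (u - x) : ℝ) : ℂ) := by
  rw [weilConv_apply]
  congr 1 with u
  simp only [weilReflect, conj_ofReal, neg_sub]

/-- The kernel `g ⋆ R̃` vanishes for `|x| > a + b` when `g` lives on `[−a, a]`. [folklore] -/
private theorem tailPrime_conv_eq_zero {g : ℝ → ℂ} {a b x : ℝ} (hab : a ≤ b)
    (hsupp : tsupport g ⊆ Icc (-a) a) (hx : a + b < |x|) :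
    weilConv g (weilReflect fun t => ((oddThetaTailTrunc a b t : ℝ) : ℂ)) x = 0 := by
  rw [tailPrime_conv_apply]
  have h0 : (fun u => g u * ((oddThetaTailTrunc a b (u - x) : ℝ) : ℂ)) = fun _ => 0 := by
    funext u
    by_cases hu : |u| ≤ a
    · have h1 : b < |u - x| := by
        have := abs_sub_abs_le_abs_sub x u
        rw [abs_sub_comm] at this
        linarith
      rw [tailPrime_trunc_eq_zero hab h1, Complex.ofReal_zero, mul_zero]
    · rw [image_eq_zero_of_notMem_tsupport fun h => hu (abs_le.2 (hsupp h)), zero_mul]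
  rw [h0, integral_zero]

/-- Beyond the radius: `n ∉ range ⌈e^{R+1}⌉` forces `R + 1 ≤ log n`. [folklore] -/
private theorem tailPrime_le_log {R : ℝ} {n : ℕ} (hn : n ∉ Finset.range ⌈Real.exp (R + 1)⌉₊) :
    R + 1 ≤ Real.log n := by
  rw [Finset.mem_range, not_lt] at hn
  have hn' : Real.exp (R + 1) ≤ n := (Nat.le_ceil _).trans (by exact_mod_cast hn)
  have hpos : (0 : ℝ) < n := (Real.exp_pos _).trans_le hn'
  rwa [Real.le_log_iff_exp_le hpos]

/-- The prime term as a finite sum when the kernel vanishes for `|u| > R` (as in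
`WeilContinuous.weilPrimeTerm_eq_sum_of_support`). [folklore] -/
private theorem tailPrime_primeTerm_eq_sum {f : ℝ → ℂ} {R : ℝ}
    (hf : ∀ u : ℝ, R < |u| → f u = 0) :
    weilPrimeTerm f = ∑ n ∈ Finset.range ⌈Real.exp (R + 1)⌉₊,
      ((Λ n : ℝ) : ℂ) / (Real.sqrt n : ℂ) * (f (Real.log n) + f (-Real.log n)) := by
  unfold weilPrimeTerm
  refine tsum_eq_sum fun n hn ↦ ?_
  have h1 : R < |Real.log n| :=
    lt_of_lt_of_le (by linarith [tailPrime_le_log hn]) (le_abs_self _)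
  rw [hf _ h1, hf _ (by rwa [abs_neg]), add_zero, mul_zero]

/-- On the window `|t| ≤ a` the truncated prime layer is a finite sum (`n < ⌈e^{a+b+1}⌉`).
[folklore] -/
private theorem tailPrime_layer_eq_sum {a b t : ℝ} (hab : a ≤ b) (ht : |t| ≤ a) :
    oddThetaPrimeLayerTrunc a b t = ∑ n ∈ Finset.range ⌈Real.exp (a + b + 1)⌉₊,
      (Λ n : ℝ) / Real.sqrt n *
        (oddThetaTailTrunc a b (t - Real.log n) + oddThetaTailTrunc a b (t + Real.log n)) := by
  unfold oddThetaPrimeLayerTrunc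
  refine tsum_eq_sum fun n hn ↦ ?_
  have hlog := tailPrime_le_log hn
  have hl : Real.log n ≤ |Real.log n| := le_abs_self _
  have h1 : b < |t - Real.log n| := by
    have := abs_sub_abs_le_abs_sub (Real.log n) t
    rw [abs_sub_comm] at this
    linarith
  have h2 : b < |t + Real.log n| := by
    have := abs_sub (t + Real.log n) t
    rw [add_sub_cancel_left] at this
    linarith
  rw [tailPrime_trunc_eq_zero hab h1, tailPrime_trunc_eq_zero hab h2, add_zero, mul_zero]

/-- **Prime term of the truncated tail kernel.** For a window test `g` on `[−a, a]` and
`0 < a ≤ b`, with `R = R_{a,b} = H_b − H_a` and `P = oddThetaPrimeLayerTrunc a b`: `g · P` is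
integrable and `Σ_n Λ(n) n^{-1/2} ((g ⋆ R̃)(log n) + (g ⋆ R̃)(−log n)) = ∫ g P`. [folklore] -/
theorem stub_tailPrime :
    ∀ (a b : ℝ) (g : ℝ → ℂ), 0 < a → a ≤ b → IsWeilTest g → tsupport g ⊆ Icc (-a) a →
      Integrable (fun t => g t * ((oddThetaPrimeLayerTrunc a b t : ℝ) : ℂ)) ∧
      weilPrimeTerm (weilConv g (weilReflect fun t => ((oddThetaTailTrunc a b t : ℝ) : ℂ))) =
        ∫ t, g t * ((oddThetaPrimeLayerTrunc a b t : ℝ) : ℂ) := by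
  intro a b g _ hab hg hsupp
  -- the summands `u ↦ g(u) (R(u − log n) + R(u + log n))` are integrable
  have hF : ∀ n : ℕ, Integrable fun u => g u *
      (((oddThetaTailTrunc a b (u - Real.log n) : ℝ) : ℂ) +
        ((oddThetaTailTrunc a b (u + Real.log n) : ℝ) : ℂ)) := fun n =>
    ((tailPrime_integrable_mul hg a b (Real.log n)).fun_add
      (tailPrime_integrable_mul' hg a b (Real.log n))).congr
      (Eventually.of_forall fun u => (mul_add _ _ _).symm)
  -- pointwise: `g P = Σ_{n<N} c_n g (R(· − log n) + R(· + log n))` (off the window `g = 0`)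
  have hpt : ∀ t : ℝ, g t * ((oddThetaPrimeLayerTrunc a b t : ℝ) : ℂ) =
      ∑ n ∈ Finset.range ⌈Real.exp (a + b + 1)⌉₊, ((Λ n : ℝ) : ℂ) / (Real.sqrt n : ℂ) *
        (g t * (((oddThetaTailTrunc a b (t - Real.log n) : ℝ) : ℂ) +
          ((oddThetaTailTrunc a b (t + Real.log n) : ℝ) : ℂ))) := by
    intro t
    by_cases hgt : g t = 0
    · simp [hgt]
    · have ht : |t| ≤ a :=
        abs_le.2 (hsupp (subset_tsupport g (Function.mem_support.2 hgt)))
      rw [tailPrime_layer_eq_sum hab ht]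
      push_cast
      rw [Finset.mul_sum]
      exact Finset.sum_congr rfl fun n _ => by ring
  have hfun : (fun t => g t * ((oddThetaPrimeLayerTrunc a b t : ℝ) : ℂ)) = fun t =>
      ∑ n ∈ Finset.range ⌈Real.exp (a + b + 1)⌉₊, ((Λ n : ℝ) : ℂ) / (Real.sqrt n : ℂ) *
        (g t * (((oddThetaTailTrunc a b (t - Real.log n) : ℝ) : ℂ) +
          ((oddThetaTailTrunc a b (t + Real.log n) : ℝ) : ℂ))) :=
    funext hpt
  have hint : ∀ n ∈ Finset.range ⌈Real.exp (a + b + 1)⌉₊, Integrable fun t =>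
      ((Λ n : ℝ) : ℂ) / (Real.sqrt n : ℂ) *
        (g t * (((oddThetaTailTrunc a b (t - Real.log n) : ℝ) : ℂ) +
          ((oddThetaTailTrunc a b (t + Real.log n) : ℝ) : ℂ))) := fun n _ =>
    (hF n).const_mul _
  refine ⟨?_, ?_⟩
  · rw [hfun]
    exact integrable_finsetSum _ hint
  · have hk0 : ∀ u : ℝ, a + b < |u| →
        weilConv g (weilReflect fun t => ((oddThetaTailTrunc a b t : ℝ) : ℂ)) u = 0 :=
      fun u hu => tailPrime_conv_eq_zero hab hsupp hu
    rw [tailPrime_primeTerm_eq_sum hk0, hfun, integral_finsetSum _ hint]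
    refine Finset.sum_congr rfl fun n _ => ?_
    rw [integral_const_mul, tailPrime_conv_apply, tailPrime_conv_apply,
      ← integral_add (tailPrime_integrable_mul hg a b (Real.log n))
        (tailPrime_integrable_mul hg a b (-Real.log n))]
    congr 1
    exact integral_congr_ae (Eventually.of_forall fun u => by simp only [mul_add, sub_neg_eq_add])

end Summit.RiemannHypothesis.RiemannHypothesis.Theorems.OddBartaFloor

end
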